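import Literature.NumberTheory.Sieve.GreenMoebiusAC0Proofs
import Literature.NumberTheory.LFunctions.GreenMoebiusACdHolds
import HarnessLib

/-!
# Green 2012, Theorem 1 for `μ` in the `Sieve` vocabulary — the discharge of `green_moebius_AC0`

Topic `Literature/NumberTheory/Sieve`, proofs-only sibling of `MoebiusWalshCircuits.lean` (the
named fact `Literature.NumberTheory.Sieve.green_moebius_AC0`) and `GreenMoebiusAC0Proofs.lean`
(the proved dedup bridge `green_moebius_AC0_of_ACd` to the `LFunctions` rendering
`Literature.NumberTheory.LFunctions.green_moebius_ACd`). B. Green, *On (not) computing the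
Möbius function using bounded depth circuits*, Combin. Probab. Comput. **21** (2012) 942–951,
Theorem 1 [Green2012]: an `AC⁰(d)` function `F : {0,…,2ⁿ-1} → {±1}` (depth `≤ d`, size `≤ n^d`)
has `𝔼_x μ(x)F(x) = O(e^{d log n - c n^{1/(6d)}})`.

The `LFunctions` twin is PROVED (`Literature.NumberTheory.LFunctions.green_moebius_ACd_holds`,
file `LFunctions/GreenMoebiusACdHolds.lean`: Green's Proposition 1 for `μ`,
`Literature.Computability.Complexity.green_moebius_fourierWalsh_holds` — Kátai's Proposition 2,
the minor-arc Proposition 4, the Harman–Kátai Lemma 1 and Corollary 2 of Theorem 3, assembled as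
printed in §§3–4 — followed by Green's §2 deduction `green_moebius_ACd_of_fourierWalsh`), so the
one-line discharge announced in `GreenMoebiusAC0Proofs.lean` applies. Nothing else is in this file.

## References

* B. Green, Combin. Probab. Comput. 21 (2012) 942–951, Theorem 1. [Green2012]
-/

namespace Literature.NumberTheory.Sieve

/-- **Green 2012, Theorem 1 (Möbius versus `AC⁰(d)`) — PROVED** in the `Sieve` rendering
(`range (2^n)`, `Nat.testBit`, sign `sgn`): from the proved `LFunctions` twin
`Literature.NumberTheory.LFunctions.green_moebius_ACd_holds` through the dedup bridge
`green_moebius_AC0_of_ACd`. [cite: Green2012, Theorem 1] -/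
theorem green_moebius_AC0_holds : green_moebius_AC0 :=
  green_moebius_AC0_of_ACd Literature.NumberTheory.LFunctions.green_moebius_ACd_holds

end Literature.NumberTheory.Sieve
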